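import Summits.MatrixMultiplication.MatrixMultiplication.Theorems.SoloInformedNearRectAssembly

/-!
# THEOREM 8.19 from line data only: heavy transversal lines are discarded inside the kernel

This work, §8.8 (T12)(f) Step 2 (last sentence) and C3-m2 §5.5 (gen 107). Setting as in
`SoloInformedNearRectAssembly`.

Step 2 of THEOREM 8.20 delivers a KIND FAMILY: a set `𝓛` of indices `j` such that column `j` of `a` is `∼ v′` off a
row set `Ea j` of size `≤ d` and row `j` of `b` is `∼ v` off a column set `Fb j` of size `≤ d` — line data only, no
control of the transversal lines (rows of `a`, columns of `b`). `Data.nearRect_lines` discards the HEAVY transversal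
lines (a row `i` lying in `> d′` of the sets `Ea j`, a column `k` lying in `> d′` of the `Fb j`; by double counting at
most `|𝓛|·d/(d′+1)` of each) and applies `Data.nearRect` with `e := d + d′` on the light box; the output is
`Data.nearRect`'s trichotomy together with the two heavy-line counts.
-/

namespace Summit.MatrixMultiplication.MatrixMultiplication.Theorems.TwistedTPP

namespace FibreLines

variable {ι G : Type*} [AddCommGroup G]
variable {G₀ : Type*} [AddCommGroup G₀] {R : Type*}

/-- **THEOREM 8.19 from line data.** [this work, §8.8 (T12)(f); C3-m2 §5.5] -/
theorem Data.nearRect_lines [Fintype ι] [DecidableEq ι] [Fintype G₀] [DecidableEq G₀] [Fintype R]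
    [DecidableEq R] [DecidableEq G] (hG : ∀ x : G, x = -x → x = 0) (D : Data ι G) (Φ : Chart ι G₀)
    (κ : G → R) (hκ : ∀ x y, κ x = κ y → SignEq x y) (hsep : D.SepAll Φ) {v v' : G} (hv : v ≠ 0)
    (hv' : v' ≠ 0) (hvv : ¬ SignEq v v') (L : Finset ι) (d d' : ℕ) (Ea Fb : ι → Finset ι)
    (hEa : ∀ j ∈ L, (Ea j).card ≤ d ∧ ∀ i, i ∉ Ea j → SignEq (D.a i j) v')
    (hFb : ∀ j ∈ L, (Fb j).card ≤ d ∧ ∀ k, k ∉ Fb j → SignEq (D.b j k) v)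
    (hL : 2 * (d + d') < L.card) :
    ∃ I₀ K₀ : Finset ι, (Fintype.card ι - I₀.card) * (d' + 1) ≤ L.card * d ∧
      (Fintype.card ι - K₀.card) * (d' + 1) ≤ L.card * d ∧
      ∃ Kc ⊆ K₀, ∃ Kp ⊆ K₀, ∃ Km ⊆ K₀, K₀.card = Kc.card + Kp.card + Km.card ∧
        Fintype.card ι * Kc.card * L.card ≤ Fintype.card R * Fintype.card G₀ ∧
        (2 * (d + d') < Kp.card → ∃ I₁ ⊆ I₀, I₀.card ≤ I₁.card + 2 * (d + d') ∧
          I₁.card * L.card * Kp.card ≤ Fintype.card G₀ + (d + d') * (L.card * Kp.card) +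
            (d + d') * (L.card * I₁.card) + (d + d') * (Kp.card * L.card)) ∧
        (2 * (d + d') < Km.card → ∃ I₁ ⊆ I₀, I₀.card ≤ I₁.card + 2 * (d + d') ∧
          I₁.card * L.card * Km.card ≤ Fintype.card G₀ + (d + d') * (L.card * Km.card) +
            (d + d') * (L.card * I₁.card) + (d + d') * (Km.card * L.card)) := by
  classical
  set I₀ : Finset ι := Finset.univ.filter fun i => (L.filter fun j => i ∈ Ea j).card ≤ d' with hI₀
  set K₀ : Finset ι := Finset.univ.filter fun k => (L.filter fun j => k ∈ Fb j).card ≤ d' with hK₀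
  -- heavy rows / columns by double counting
  have heavy : ∀ (X : ι → Finset ι), (∀ j ∈ L, (X j).card ≤ d) →
      (Fintype.card ι - (Finset.univ.filter fun i => (L.filter fun j => i ∈ X j).card ≤ d').card) *
        (d' + 1) ≤ L.card * d := by
    intro X hX
    set H : Finset ι := Finset.univ.filter fun i => ¬ (L.filter fun j => i ∈ X j).card ≤ d' with hH
    have hsplit : (Finset.univ.filter fun i => (L.filter fun j => i ∈ X j).card ≤ d').card + H.card =
        Fintype.card ι := by
      rw [← Finset.card_univ]; exact Finset.card_filter_add_card_filter_not _
    have hcount : H.card • (d' + 1) ≤ L.card • d := by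
      refine Finset.card_nsmul_le_card_nsmul (r := fun i j => i ∈ X j) ?_ ?_
      · intro i hi
        have h1 : ¬ (L.filter fun j => i ∈ X j).card ≤ d' := (Finset.mem_filter.1 hi).2
        have h2 : (L.filter fun j => i ∈ X j) = L.bipartiteAbove (fun i j => i ∈ X j) i := rfl
        exact le_trans (by omega) (le_of_eq (congrArg Finset.card h2))
      · intro j hj
        have hsub : H.bipartiteBelow (fun i j => i ∈ X j) j ⊆ X j := by
          intro i hi
          rw [Finset.mem_bipartiteBelow] at hi
          exact hi.2
        exact (Finset.card_le_card hsub).trans (hX j hj)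
    rw [smul_eq_mul, smul_eq_mul] at hcount
    have : Fintype.card ι - (Finset.univ.filter fun i => (L.filter fun j => i ∈ X j).card ≤ d').card =
        H.card := by omega
    rw [this]; exact hcount
  refine ⟨I₀, K₀, heavy Ea fun j hj => (hEa j hj).1, heavy Fb fun j hj => (hFb j hj).1, ?_⟩
  -- the four exception-set hypotheses of `Data.nearRect` with `e := d + d'`
  have hac : ∀ j ∈ L, ∃ E : Finset ι, E.card ≤ d + d' ∧ ∀ i ∈ I₀, i ∉ E → SignEq (D.a i j) v' :=
    fun j hj => ⟨Ea j, by have := (hEa j hj).1; omega, fun i _ hi => (hEa j hj).2 i hi⟩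
  have har : ∀ i ∈ I₀, ∃ E : Finset ι, E.card ≤ d + d' ∧ ∀ j ∈ L, j ∉ E → SignEq (D.a i j) v' := by
    intro i hi
    refine ⟨L.filter fun j => i ∈ Ea j, by have := (Finset.mem_filter.1 hi).2; omega, fun j hj hjE => ?_⟩
    exact (hEa j hj).2 i fun h => hjE (Finset.mem_filter.2 ⟨hj, h⟩)
  have hbr : ∀ j ∈ L, ∃ E : Finset ι, E.card ≤ d + d' ∧ ∀ k ∈ K₀, k ∉ E → SignEq (D.b j k) v :=
    fun j hj => ⟨Fb j, by have := (hFb j hj).1; omega, fun k _ hk => (hFb j hj).2 k hk⟩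
  have hbc : ∀ k ∈ K₀, ∃ E : Finset ι, E.card ≤ d + d' ∧ ∀ j ∈ L, j ∉ E → SignEq (D.b j k) v := by
    intro k hk
    refine ⟨L.filter fun j => k ∈ Fb j, by have := (Finset.mem_filter.1 hk).2; omega, fun j hj hjE => ?_⟩
    exact (hFb j hj).2 k fun h => hjE (Finset.mem_filter.2 ⟨hj, h⟩)
  exact D.nearRect hG Φ κ hκ hsep hv hv' hvv I₀ L K₀ (d + d') hac har hbr hbc hL

end FibreLines

end Summit.MatrixMultiplication.MatrixMultiplication.Theorems.TwistedTPP
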